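import Summits.Ventures.YMGap.Thresholds.StarSU3CertifiedRows
import Summits.Ventures.YMGap.SlabAreaLawSU3Radius
import Summits.Ventures.YMGap.Census.CoeffMonotone
import Summits.Ventures.YMGap.Census.CharacterTwistBound
import Summits.Ventures.YMGap.Census.HypercubeExponentQuarter
import Summits.Ventures.YMGap.Census.ZplusMonotone
import HarnessLib

/-!
# Venture statement — YMGap (cell `pub-ymgap`) — CONJUNCT BODIES for the v1.3 append of `Statement.lean` (T17, T19, T20)

HONEST FRAMING. WHAT THIS IS: from v1.3 on, the venture statement `Summits/Ventures/YMGap/Statement.lean`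
(the file of record, append-only, review-protected) stays an INDEX: the bodies `Tk_… : Prop` of new
conjuncts and their witnesses `Tk_…_holds` live in per-version files like this one (the tree caps every file
at 400 lines; `Statement.lean` reached 391 at v1.2), and `Statement.lean` appends only
`YMGapStatementV1_3 := YMGapStatementV1_2 ∧ T17 ∧ T19 ∧ T20` with its proof. Numbering is global across
versions: T16 (the hypothesis-free `ImprovedThreshold d N (1/(8d))` capstone) and T18 (the
general-dimension star rows) are RESERVED for files not yet in the tree when this block was written.

The three conjuncts here are kernel-checked (axioms `propext`, `Classical.choice`, `Quot.sound`):
* **T17** (track (b), UNCONDITIONAL): Tomboulis's undisputed reflection-positivity propositions — II.1 (i)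
  coefficient monotonicity, IV.1 `Z⁻ ≤ Z` in every plane, IV.2 (i) `Z⁺` monotone, II.1 (ii) with the
  Appendix-A exponent `L^d/4`, and `Z⁻ ≥ 0` — on EVERY even torus `(ℤ/Lℤ)^d`, EVERY spin cut-off; finite
  volume; NOTHING about the disputed (5.15), the thermodynamic limit or confinement;
* **T19** (`SU(3)`, `d = 4`): `MassGapAt 4 3 (β_W/9)` and every DLR state massive with exponentially
  decaying plaquette–plaquette correlations at every Wilson `|β_W| ≤ 11/20`, CONDITIONAL on two DISPLAYED
  one-link certificates H1 `OneLinkPoincareSUN 3 (3/5) (4/5)`, H2 `OneLinkVarianceBound 3 (11/30) (49/20)`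
  (finite-dimensional inequalities about one tilted Haar law on `SU(3)`, certified by ball arithmetic
  OUTSIDE the kernel — class «K × C⁻(H1) × C-iv(H2)» in the cell's books; binders here, asserted nowhere);
* **T20** (`SU(3)`, `d = 4`): Wilson area law for every `0 ≤ β_W ≤ 9/10`, CONDITIONAL on H1 and
  H2′ `OneLinkVarianceBound 3 (3/5) (17/5)` (displayed; printed threshold `3/8`).
WHAT THIS IS NOT: no continuum statement, no clustering rate beyond `∃ m > 0`, no spectral gap, lattice
strong coupling only, no claim on the Yang–Mills Millennium problem, no verdict on Tomboulis's (5.15).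
-/

noncomputable section

namespace Summit.Ventures.YMGap

open Literature.MathematicalPhysics.QuantumFieldTheory
open Literature.Probability.LatticeModels (HasUniqueGibbsMeasure HasExponentialDecay)
open Literature.MathematicalPhysics.QuantumLattice (fundamentalRep ymGibbsMeasures plaquetteCorrFn)
open Literature.Barriers.QuantumFields (IsMassiveState)
open Summit.QuantumFields.BalabanUV.InfraRed.StrongCouplingVarianceDoorSUN (OneLinkVarianceBound)
open Summit.QuantumFields.BalabanUV.InfraRed.StrongCouplingPoincareDoorSUN (OneLinkPoincareSUN)

/-- **T17 — track (b): Tomboulis's UNDISPUTED reflection-positivity propositions hold on EVERY even torus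
`(ℤ/Lℤ)^d` (`L ≥ 2` even), for EVERY spin cut-off `J`, as kernel theorems, UNCONDITIONAL**
(arXiv:0707.2179; truncated character expansions with admissible coefficients `0 ≤ c_j ≤ 1`):
(i) Prop. II.1 (i) eq. (2.12): `Z_Λ({c_j})` is increasing in the coefficients — `CoeffMonotone d L J`
(`Census.coeffMonotone`); (ii) Prop. IV.1 eq. (4.6): `Z⁻_Λ(𝒱_{ij}) ≤ Z_Λ` for the vortex sheet in every
plane, `d ≥ 2` — `TwistLe d L J (vortexSheet L i j _)` (`Census.twistLe_vortexSheet_plane`);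
(iii) Prop. IV.2 (i) eq. (4.9): `Z⁺_Λ = (Z_Λ + Z⁻_Λ)/2` is increasing in the coefficients, every plane
(`Census.torusZplus_mono`); (iv) Prop. II.1 (ii) eq. (2.13) with the exponent its Appendix-A chessboard
argument delivers, `d ≥ 3`: `Z_Λ ≥ (1 + Σ_j d_j² c_j⁶)^{L^d/4}` — `HypercubeLowerBoundExp d L J (L^d/4)`
(`Census.hypercubeLowerBoundExp_quarter`; the PRINTED exponent `|Λ|` read as the number of plaquettes
FAILS on `(ℤ/3)³`, T8 (i)); (v) the left half of (5.3) in weak form, `d ≥ 3`: `0 ≤ Z⁻_Λ(𝒱_{ij})` for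
`c_j ≥ 0` (`Census.torusZtw_vortexSheet_nonneg`). Finite-torus statements; nothing about the disputed
(5.15), the thermodynamic limit or confinement (seat lit-2). -/
def T17_TomboulisRPEvenTorus : Prop :=
  ∀ (d L : ℕ) [NeZero d] [NeZero L] [Fact (1 < L)], Even L → ∀ J : ℕ,
    Tomboulis2007.CoeffMonotone d L J ∧
      (∀ (i j : Fin d) (hij : i < j), (0 : Fin d) < 1 →
        Tomboulis2007.TwistLe d L J (Tomboulis2007.vortexSheet L i j hij)) ∧
      (∀ (i j : Fin d) (hij : i < j) (c c' : ℕ → ℝ), Tomboulis2007.CoeffAdmissible c →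
        Tomboulis2007.CoeffAdmissible c' → (∀ n, c n ≤ c' n) →
          Tomboulis2007.torusZplus d L J c (Tomboulis2007.vortexSheet L i j hij) ≤
            Tomboulis2007.torusZplus d L J c' (Tomboulis2007.vortexSheet L i j hij)) ∧
      (3 ≤ d → Tomboulis2007.HypercubeLowerBoundExp d L J (L ^ d / 4)) ∧
      (3 ≤ d → ∀ (i j : Fin d) (hij : i < j) (c : ℕ → ℝ), (∀ n, 1 ≤ n → 0 ≤ c n) →
        0 ≤ Tomboulis2007.torusZtw d L J c (Tomboulis2007.vortexSheet L i j hij))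

/-- T17 holds (`Census.coeffMonotone`, `Census.twistLe_vortexSheet_plane`, `Census.torusZplus_mono`,
`Census.hypercubeLowerBoundExp_quarter`, `Census.torusZtw_vortexSheet_nonneg`). -/
theorem T17_TomboulisRPEvenTorus_holds : T17_TomboulisRPEvenTorus :=
  fun _ _ _ _ _ hL J => ⟨Census.coeffMonotone hL J,
    fun _ _ hij h01 => Census.twistLe_vortexSheet_plane hL h01 J hij,
    fun _ _ hij _ _ hc hc' hle => Census.torusZplus_mono hL J hij hc hc' hle,
    fun hd => Census.hypercubeLowerBoundExp_quarter hd hL J,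
    fun hd _ _ hij _ hc => Census.torusZtw_vortexSheet_nonneg hd hL J hij hc⟩

/-- **T19 — `SU(3)`, `d = 4` (Wilson `β_W = 6/g²`, tree coupling `β_W/3`, 't Hooft `β_W/9`): mass gap and
massive DLR states at every `|β_W| ≤ 11/20`, two-sided, CONDITIONAL on the cell's two DISPLAYED one-link
certificates** H1 `OneLinkPoincareSUN 3 (3/5) (4/5)` (spectral gap `≥ 5/4` of the tilted one-link law on
the operator-norm ball of radius `3/5`) and H2 `OneLinkVarianceBound 3 (11/30) (49/20)` — finite-dimensional
inequalities certified by ball arithmetic outside the kernel (class «K × C⁻(H1) × C-iv(H2)»), binders here,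
asserted nowhere: (i) `MassGapAt 4 3 (β_W/9)` (unique DLR state + exponential clustering of Lipschitz
cylinder observables); (ii) every DLR state of the Wilson specification at `β_W/3` is massive and its
plaquette–plaquette correlation function decays exponentially
(`StarSU3Certified.su3_massGapAt_abs_le_of_certificates`,
`StarSU3Certified.su3_isMassiveState_dlr_abs_le_of_certificates`,
`StarSU3Certified.su3_hasExponentialDecay_plaquetteCorrFn_dlr_abs_le_of_certificates`; seat engine-2).
Same predicate, other classes: `81/308` hypothesis-free (T11–T14 at `N = 3`), printed `3/16`. -/
def T19_SU3CertifiedRows : Prop :=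
  OneLinkPoincareSUN 3 (3 / 5) (4 / 5) → OneLinkVarianceBound 3 (11 / 30) (49 / 20) →
    ∀ βW : ℝ, |βW| ≤ 11 / 20 →
      MassGapAt 4 3 (βW / 9) ∧
        ∀ μ ∈ ymGibbsMeasures (d := 4) (fundamentalRep (Fin 3)) (βW / 3),
          IsMassiveState μ ∧ HasExponentialDecay (plaquetteCorrFn (fundamentalRep (Fin 3)) μ)

/-- T19 holds (`StarSU3Certified.su3_massGapAt_abs_le_of_certificates`,
`StarSU3Certified.su3_isMassiveState_dlr_abs_le_of_certificates`,
`StarSU3Certified.su3_hasExponentialDecay_plaquetteCorrFn_dlr_abs_le_of_certificates`). -/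
theorem T19_SU3CertifiedRows_holds : T19_SU3CertifiedRows :=
  fun hP hv _ h => ⟨StarSU3Certified.su3_massGapAt_abs_le_of_certificates hP hv h, fun μ hμ =>
    ⟨StarSU3Certified.su3_isMassiveState_dlr_abs_le_of_certificates hP hv h μ hμ,
      StarSU3Certified.su3_hasExponentialDecay_plaquetteCorrFn_dlr_abs_le_of_certificates hP hv h μ hμ⟩⟩

/-- **T20 — `SU(3)`, `d = 4`: Wilson AREA LAW for every `0 ≤ β_W ≤ 9/10`, CONDITIONAL on two DISPLAYED
one-link hypotheses at radius `3/5`** — H1 `OneLinkPoincareSUN 3 (3/5) (4/5)` and H2′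
`OneLinkVarianceBound 3 (3/5) (17/5)` (finite-dimensional inequalities about ONE tilted Haar law on `SU(3)`,
certified by the cell outside the kernel, class «K × C⁻»; binders here, asserted nowhere). The
Durhuus–Fröhlich / Cao–Nissim–Sheffield slab criterion is DISCHARGED in the tree, so nothing else is
assumed; slab door product `(3/5)²·(4/5)(17/5) = 612/625 < 1`. Printed comparison: CNS 2025 Thm. 1.6
gives `β_W < 3/8`; T5's method at `SU(3)` radius `11/30` gives `11/20`
(`Slab.su3_hasAreaLaw_le_nineTenths_of_poincare_of_varianceBound`; seat engine-2). -/
def T20_SU3AreaLawNineTenths : Prop :=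
  OneLinkPoincareSUN 3 (3 / 5) (4 / 5) → OneLinkVarianceBound 3 (3 / 5) (17 / 5) →
    ∀ βW : ℝ, 0 ≤ βW → βW ≤ 9 / 10 → HasAreaLaw 4 (fundamentalRep (Fin 3)) (βW / 3)

/-- T20 holds (`Slab.su3_hasAreaLaw_le_nineTenths_of_poincare_of_varianceBound`). -/
theorem T20_SU3AreaLawNineTenths_holds : T20_SU3AreaLawNineTenths :=
  fun hP hv _ hβ hle => Slab.su3_hasAreaLaw_le_nineTenths_of_poincare_of_varianceBound hP hv hβ hle

end Summit.Ventures.YMGap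

end
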